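import Mathlib.Analysis.Complex.ExponentialBounds
import Summits.QuantumFields.YangMills.Theorems.UV3BranchExpansionCountingRecursion
import HarnessLib

/-!
# `UV3BranchExpansionCountingSmallness` — the two closed SMALLNESS ROWS of hTop's amortized count (`hsmallE`, `hsmallG` of
# ✓`UV3BranchExpansionCountingAmortizedUniform.sum_pow_card_le_exp_of_smallness`) reduced to LINEAR sufficient conditions, an
# `∃ x₀ > 0` threshold, and the T³ numeral at `L = d = 3` (crux `UnitScaleTilt.HistoryTailL`, stmt-QuantumFields-19936 — SUPPLY side)

Cell `ym3-torus` (YM ladder rung R3 = continuum SU(2) Yang–Mills on T³ — a RUNG, NOT d = 4, NOT infinite volume, NOT a mass gap, NOT Clay);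
width seat `ym3-torus-px13` (gen 14), explicit-unit helper; `--supports stmt-QuantumFields-19936 --as helper`.  THEOREMS ONLY (0 `def`,
0 `sorry`, default heartbeats); imports ✓`UV3BranchExpansionCountingRecursion` (px13 g13) for `one_add_pow_le_exp_mul` only.

WHAT.  The level-uniform amortized covering inequality (w2 g17's U ✓p761442; w5 g19's T³ instance `…CountingT3`) closes under two closed
numerical rows in the letters `x ≥ 0` (element weight), `0 < y ≤ 1` (amortisation weight), `θ₀ < 1` (contraction), `M := 2/(1−θ₀)`,
`x' := x / y^{s₀}` and the lattice constants `r₀, ρ₀, s₀, L`: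
  `hsmallE : (1 + M·x')^{r₀} ≤ 2`,   `hsmallG : (y + M·x')^{L−1} · (1 + 2x'/y)^{(L−1)ρ₀} ≤ θ₀`.
THIS FILE ([folklore] real inequalities; token shape of U's binders):
 §1 `exp_half_lt_two`, `one_add_pow_le_two` (`0 ≤ t`, `r·t ≤ 1/2 ⇒ (1+t)^r ≤ 2`); (`0 ≤ u ≤ 1 ⇒ e^u ≤ 1 + 2u` is Mathlib's `Real.abs_exp_sub_one_le`,
    used inline — the named form is lit ✓`Literature.NumberTheory.Sieve.exp_le_one_add_two_mul`, not imported to keep the cone small).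
 §2 ★ `hsmallE_of_linear` : `r₀·M·x' ≤ 1/2 ⇒ hsmallE`.
 §3 `hsmallG_le_pow_mul_exp` : the ghost row is `≤ y^{L−1}·exp A`, `A := (L−1)·(M + 2ρ₀)·x'/y` (no smallness needed);
    ★ `hsmallG_of_exp` : `y^{L−1}·exp A ≤ θ₀ ⇒ hsmallG`;  ★ `hsmallG_of_linear` : `A ≤ 1 ∧ y^{L−1}(1 + 2A) ≤ θ₀ ⇒ hsmallG`.
 §4 ★★ `exists_threshold_of_lt` : `0 < y`, `θ₀ < 1`, `y^{L−1} < θ₀ ⇒ ∃ x₀ > 0, ∀ x ∈ [0, x₀], hsmallE ∧ hsmallG`;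
    ★★ `exists_smallness_threshold` : `2 ≤ L`, `0 < y < 1 ⇒ ∃ θ₀ < 1, ∃ x₀ > 0, ∀ x ∈ [0, x₀], hsmallE ∧ hsmallG` — the qualitative row the
    (F-TOP) assembly can `obtain` when its element weight is «small enough».
 (§5 — the T³ NUMERAL instance `x ≤ 3·10⁻⁵ ⇒ both rows at (r₀,ρ₀,s₀,L,y,θ₀) = (162,6,10,3,9/10,17/20)` — lives in the separate numerals file
    `UV3BranchExpansionCountingSmallnessT3` with the Haar-ball numbers of `UV3BranchExpansionHaarBallSharp`, so that THIS file stays numeral-free: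
    OWNER WORD 89 (5)(c), reader flag px16 g12 2026-08-30.)

HONEST SCOPE.  Elementary real analysis; nothing model-specific; sufficient conditions on `x`, no claim about any model's `x`.
Nothing of hTop, (F-TOP), the χ record `AlphaInputsT3ACv4RecChi`, (O‴χₛ), `HistoryTailL`, R3 is proved; the Yang–Mills mass gap is
NOT proved.

References: T. Bałaban, CMP **102** (1985) 255–275 [Balaban1985UV3]; LEAD note `Cruxes/HistoryTailL/HTopBranchExpansion.md` v1.2 §5 (C′), §6;
OWNER WORD 89 (5)(c) (numerals in the memo; rows `∃ θ₀ < 1`-shaped).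
-/

set_option autoImplicit false

namespace Summit.QuantumFields.YangMills.Theorems.UV3BranchExpansionCountingSmallness

open Summit.QuantumFields.YangMills.Theorems.UV3BranchExpansionCountingRecursion (one_add_pow_le_exp_mul)

/-! ## §1 [folklore] two elementary exponential inequalities -/

/-- `exp(1/2) < 2` (`exp(1/2)² = e < 2.72 < 4`). [folklore] -/
theorem exp_half_lt_two : Real.exp (1 / 2 : ℝ) < 2 := by
  have h1 : Real.exp 1 < 2.7182818286 := Real.exp_one_lt_d9
  have h2 : Real.exp (1 / 2 : ℝ) ^ 2 = Real.exp 1 := by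
    rw [← Real.exp_nat_mul]; norm_num
  have h3 : 0 < Real.exp (1 / 2 : ℝ) := Real.exp_pos _
  nlinarith

/-- `0 ≤ t`, `r·t ≤ 1/2 ⇒ (1 + t)^r ≤ 2` (`(1+t)^r ≤ e^{rt} ≤ e^{1/2} < 2`). [folklore] -/
theorem one_add_pow_le_two {t : ℝ} {r : ℕ} (ht : 0 ≤ t) (h : (r : ℝ) * t ≤ 1 / 2) : (1 + t) ^ r ≤ 2 := by
  refine (one_add_pow_le_exp_mul ht r).trans ?_
  have h1 : Real.exp ((r : ℝ) * t) ≤ Real.exp (1 / 2) := Real.exp_le_exp.mpr h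
  linarith [exp_half_lt_two]

/-! ## §2 The element row `hsmallE` from a linear condition -/

section Rows

variable {x y θ₀ : ℝ} {r₀ L ρ₀ s₀ : ℕ}

/-- `x' = x/y^{s₀} ≥ 0` for `x ≥ 0`, `y > 0`. [folklore] -/
theorem xprime_nonneg (hx : 0 ≤ x) (hy : 0 < y) : 0 ≤ x / y ^ s₀ := div_nonneg hx (pow_nonneg hy.le _)

/-- `M = 2/(1−θ₀) > 0` for `θ₀ < 1`. [folklore] -/
theorem M_pos (hθ₀ : θ₀ < 1) : 0 < 2 / (1 - θ₀) := div_pos two_pos (by linarith)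

/-- ★ **`hsmallE` FROM A LINEAR CONDITION**: `r₀·(2/(1−θ₀))·(x/y^{s₀}) ≤ 1/2 ⇒ (1 + (2/(1−θ₀))·(x/y^{s₀}))^{r₀} ≤ 2`. [folklore] -/
theorem hsmallE_of_linear (hx : 0 ≤ x) (hy : 0 < y) (hθ₀ : θ₀ < 1)
    (h : (r₀ : ℝ) * (2 / (1 - θ₀) * (x / y ^ s₀)) ≤ 1 / 2) :
    (1 + 2 / (1 - θ₀) * (x / y ^ s₀)) ^ r₀ ≤ 2 :=
  one_add_pow_le_two (mul_nonneg (M_pos hθ₀).le (xprime_nonneg hx hy)) h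

/-! ## §3 The ghost row `hsmallG`: exponential envelope and a linear condition -/

/-- **THE GHOST ROW UNDER AN EXPONENTIAL ENVELOPE** (no smallness needed): with `x' = x/y^{s₀}`, `M = 2/(1−θ₀)`,
`(y + M x')^{L−1}·(1 + 2x'/y)^{(L−1)ρ₀} ≤ y^{L−1}·exp((L−1)·(M + 2ρ₀)·x'/y)` (`y + Mx' = y(1 + Mx'/y)`, `1 + u ≤ e^u`). [folklore] -/
theorem hsmallG_le_pow_mul_exp (hx : 0 ≤ x) (hy : 0 < y) (hθ₀ : θ₀ < 1) :
    (y + 2 / (1 - θ₀) * (x / y ^ s₀)) ^ (L - 1) * (1 + 2 * (x / y ^ s₀) / y) ^ ((L - 1) * ρ₀) ≤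
      y ^ (L - 1) * Real.exp (((L - 1 : ℕ) : ℝ) * (2 / (1 - θ₀) + 2 * ρ₀) * (x / y ^ s₀) / y) := by
  set u : ℝ := x / y ^ s₀ with hu
  set M : ℝ := 2 / (1 - θ₀) with hM
  have hu0 : 0 ≤ u := xprime_nonneg hx hy
  have hM0 : 0 < M := M_pos hθ₀
  have hy0 : 0 ≤ y := hy.le
  have hMu : 0 ≤ M * u / y := div_nonneg (mul_nonneg hM0.le hu0) hy0
  have h2u : 0 ≤ 2 * u / y := div_nonneg (by linarith) hy0
  -- factor `y` out of the first base
  have e1 : y + M * u = y * (1 + M * u / y) := by field_simp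
  have h1 : (1 + M * u / y) ^ (L - 1) ≤ Real.exp (((L - 1 : ℕ) : ℝ) * (M * u / y)) :=
    one_add_pow_le_exp_mul hMu _
  have h2 : (1 + 2 * u / y) ^ ((L - 1) * ρ₀) ≤ Real.exp ((((L - 1) * ρ₀ : ℕ) : ℝ) * (2 * u / y)) :=
    one_add_pow_le_exp_mul h2u _
  have hA : ((L - 1 : ℕ) : ℝ) * (M * u / y) + (((L - 1) * ρ₀ : ℕ) : ℝ) * (2 * u / y) =
      ((L - 1 : ℕ) : ℝ) * (M + 2 * ρ₀) * u / y := by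
    push_cast; ring
  calc (y + M * u) ^ (L - 1) * (1 + 2 * u / y) ^ ((L - 1) * ρ₀)
      = y ^ (L - 1) * ((1 + M * u / y) ^ (L - 1) * (1 + 2 * u / y) ^ ((L - 1) * ρ₀)) := by rw [e1, mul_pow]; ring
    _ ≤ y ^ (L - 1) * (Real.exp (((L - 1 : ℕ) : ℝ) * (M * u / y)) * Real.exp ((((L - 1) * ρ₀ : ℕ) : ℝ) * (2 * u / y))) := by
        apply mul_le_mul_of_nonneg_left _ (pow_nonneg hy0 _)
        exact mul_le_mul h1 h2 (by positivity) (Real.exp_pos _).le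
    _ = y ^ (L - 1) * Real.exp (((L - 1 : ℕ) : ℝ) * (M + 2 * ρ₀) * u / y) := by rw [← Real.exp_add, hA]

/-- ★ **`hsmallG` FROM THE EXPONENTIAL (log-sharp) CONDITION**: `y^{L−1}·exp((L−1)(M + 2ρ₀)x'/y) ≤ θ₀ ⇒ hsmallG`. [folklore] -/
theorem hsmallG_of_exp (hx : 0 ≤ x) (hy : 0 < y) (hθ₀ : θ₀ < 1)
    (h : y ^ (L - 1) * Real.exp (((L - 1 : ℕ) : ℝ) * (2 / (1 - θ₀) + 2 * ρ₀) * (x / y ^ s₀) / y) ≤ θ₀) :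
    (y + 2 / (1 - θ₀) * (x / y ^ s₀)) ^ (L - 1) * (1 + 2 * (x / y ^ s₀) / y) ^ ((L - 1) * ρ₀) ≤ θ₀ :=
  (hsmallG_le_pow_mul_exp hx hy hθ₀).trans h

/-- ★ **`hsmallG` FROM A LINEAR CONDITION**: with `A := (L−1)·(2/(1−θ₀) + 2ρ₀)·(x/y^{s₀})/y`, if `A ≤ 1` and `y^{L−1}·(1 + 2A) ≤ θ₀` then
`(y + (2/(1−θ₀))(x/y^{s₀}))^{L−1}·(1 + 2(x/y^{s₀})/y)^{(L−1)ρ₀} ≤ θ₀` (`e^A ≤ 1 + 2A` on `[0, 1]`). [folklore] -/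
theorem hsmallG_of_linear (hx : 0 ≤ x) (hy : 0 < y) (hθ₀ : θ₀ < 1)
    (hA : ((L - 1 : ℕ) : ℝ) * (2 / (1 - θ₀) + 2 * ρ₀) * (x / y ^ s₀) / y ≤ 1)
    (h : y ^ (L - 1) * (1 + 2 * (((L - 1 : ℕ) : ℝ) * (2 / (1 - θ₀) + 2 * ρ₀) * (x / y ^ s₀) / y)) ≤ θ₀) :
    (y + 2 / (1 - θ₀) * (x / y ^ s₀)) ^ (L - 1) * (1 + 2 * (x / y ^ s₀) / y) ^ ((L - 1) * ρ₀) ≤ θ₀ := by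
  refine hsmallG_of_exp hx hy hθ₀ (le_trans ?_ h)
  set A : ℝ := ((L - 1 : ℕ) : ℝ) * (2 / (1 - θ₀) + 2 * ρ₀) * (x / y ^ s₀) / y with hAdef
  have hA0 : 0 ≤ A := by
    have := M_pos hθ₀; have := xprime_nonneg (s₀ := s₀) hx hy; positivity
  -- `e^A ≤ 1 + 2A` on `[0, 1]` (Mathlib `Real.abs_exp_sub_one_le`)
  have hexp : Real.exp A ≤ 1 + 2 * A := by
    have hu : |A| ≤ 1 := by rw [abs_of_nonneg hA0]; exact hA
    have h1 := (abs_le.mp (Real.abs_exp_sub_one_le hu)).2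
    rw [abs_of_nonneg hA0] at h1
    linarith
  exact mul_le_mul_of_nonneg_left hexp (pow_nonneg hy.le _)

/-! ## §4 Thresholds: `∃ x₀ > 0` below which both rows hold -/

/-- If `0 ≤ κ`, `0 < c`, `u ≤ c/(κ + 1)` then `κ·u ≤ c`. [folklore] -/
theorem mul_le_of_le_div_add_one {κ c u : ℝ} (hκ : 0 ≤ κ) (hc : 0 < c) (hu : u ≤ c / (κ + 1)) : κ * u ≤ c := by
  have hk1 : 0 < κ + 1 := by linarith
  calc κ * u ≤ κ * (c / (κ + 1)) := mul_le_mul_of_nonneg_left hu hκ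
    _ = c * (κ / (κ + 1)) := by ring
    _ ≤ c * 1 := by
        apply mul_le_mul_of_nonneg_left _ hc.le
        rw [div_le_one hk1]; linarith
    _ = c := mul_one c

/-- ★★ **A THRESHOLD FOR BOTH ROWS AT GIVEN `(y, θ₀)`**: if `0 < y`, `θ₀ < 1` and `y^{L−1} < θ₀`, there is `x₀ > 0` such that every `0 ≤ x ≤ x₀` satisfies
`hsmallE` and `hsmallG` (explicitly: `x₀ = y^{s₀}·min(…)` of the three linear constraints of §2–§3). [folklore] -/
theorem exists_threshold_of_lt (r₀ ρ₀ s₀ L : ℕ) (hy : 0 < y) (hθ₀ : θ₀ < 1) (hyθ : y ^ (L - 1) < θ₀) :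
    ∃ x₀ : ℝ, 0 < x₀ ∧ ∀ x : ℝ, 0 ≤ x → x ≤ x₀ →
      (1 + 2 / (1 - θ₀) * (x / y ^ s₀)) ^ r₀ ≤ 2 ∧
      (y + 2 / (1 - θ₀) * (x / y ^ s₀)) ^ (L - 1) * (1 + 2 * (x / y ^ s₀) / y) ^ ((L - 1) * ρ₀) ≤ θ₀ := by
  set M : ℝ := 2 / (1 - θ₀) with hM
  have hM0 : 0 < M := M_pos hθ₀
  set C : ℝ := ((L - 1 : ℕ) : ℝ) * (M + 2 * ρ₀) with hC
  have hC0 : 0 ≤ C := by positivity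
  set P : ℝ := y ^ (L - 1) with hP
  have hP0 : 0 < P := pow_pos hy _
  have hε : 0 < θ₀ - P := by linarith
  have hys : 0 < y ^ s₀ := pow_pos hy _
  -- the three linear constraints on `u = x / y^{s₀}`: `(2 r₀ M)·u ≤ 1`, `C·u ≤ y`, `(2 P C)·u ≤ y (θ₀ − P)`
  set u₀ : ℝ := min (1 / (2 * (r₀ : ℝ) * M + 1)) (min (y / (C + 1)) (y * (θ₀ - P) / (2 * P * C + 1))) with hu₀
  have hu₀pos : 0 < u₀ := by
    refine lt_min (by positivity) (lt_min (by positivity) (by positivity))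
  refine ⟨y ^ s₀ * u₀, mul_pos hys hu₀pos, fun x hx0 hxle => ?_⟩
  set u : ℝ := x / y ^ s₀ with hu
  have hu0 : 0 ≤ u := xprime_nonneg hx0 hy
  have hule : u ≤ u₀ := by
    rw [hu, div_le_iff₀ hys]; linarith
  have ha : 2 * (r₀ : ℝ) * M * u ≤ 1 :=
    mul_le_of_le_div_add_one (by positivity) one_pos (hule.trans (min_le_left _ _))
  have hb : C * u ≤ y :=
    mul_le_of_le_div_add_one hC0 hy (hule.trans ((min_le_right _ _).trans (min_le_left _ _)))
  have hc : 2 * P * C * u ≤ y * (θ₀ - P) :=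
    mul_le_of_le_div_add_one (by positivity) (by positivity) (hule.trans ((min_le_right _ _).trans (min_le_right _ _)))
  refine ⟨hsmallE_of_linear hx0 hy hθ₀ ?_, hsmallG_of_linear hx0 hy hθ₀ ?_ ?_⟩
  · -- `r₀ · (M u) ≤ 1/2`
    have : (r₀ : ℝ) * (M * u) = (2 * (r₀ : ℝ) * M * u) / 2 := by ring
    rw [← hu, this]; linarith
  · -- `C u / y ≤ 1`
    rw [← hu, ← hC, div_le_one hy]; exact hb
  · -- `P (1 + 2 C u / y) ≤ θ₀`
    rw [← hu, ← hC, ← hP]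
    have e : P * (1 + 2 * (C * u / y)) = P + (2 * P * C * u) / y := by field_simp
    rw [e]
    have h3 : (2 * P * C * u) / y ≤ θ₀ - P := by rw [div_le_iff₀ hy]; linarith
    linarith

/-- ★★ **THE QUALITATIVE SMALLNESS ROW**: for `2 ≤ L` and every amortisation weight `0 < y < 1` there are a contraction `θ₀ < 1` and a threshold `x₀ > 0` such
that every element weight `0 ≤ x ≤ x₀` satisfies BOTH closed rows of ✓`sum_pow_card_le_exp_of_smallness` (`θ₀ := (1 + y^{L−1})/2`). This is the `∃ θ₀ < 1`-shaped row
of OWNER WORD 89 (5)(c) with «`x` small enough» made precise; the assembly `obtain`s `θ₀, x₀`. [folklore] -/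
theorem exists_smallness_threshold (r₀ ρ₀ s₀ : ℕ) {L : ℕ} (hL : 2 ≤ L) (hy : 0 < y) (hy1 : y < 1) :
    ∃ θ₀ : ℝ, θ₀ < 1 ∧ ∃ x₀ : ℝ, 0 < x₀ ∧ ∀ x : ℝ, 0 ≤ x → x ≤ x₀ →
      (1 + 2 / (1 - θ₀) * (x / y ^ s₀)) ^ r₀ ≤ 2 ∧
      (y + 2 / (1 - θ₀) * (x / y ^ s₀)) ^ (L - 1) * (1 + 2 * (x / y ^ s₀) / y) ^ ((L - 1) * ρ₀) ≤ θ₀ := by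
  have hP1 : y ^ (L - 1) < 1 := pow_lt_one₀ hy.le hy1 (by omega)
  refine ⟨(1 + y ^ (L - 1)) / 2, by linarith, ?_⟩
  exact exists_threshold_of_lt r₀ ρ₀ s₀ L hy (by linarith) (by linarith)

end Rows

end Summit.QuantumFields.YangMills.Theorems.UV3BranchExpansionCountingSmallness
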